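import Summits.CriticalPhenomena.CardyFormulaZ2.Theorems.CardyAnchoredRigidityCardyShadowIsolatedDilationDynamicsGlue
import HarnessLib.Audit

/-!
# Skeleton for crux `CardyShadowIsolated` (stmt-CriticalPhenomena-5767) — line `dilation-dynamics`, v3 (lead c3, 2026-08-17)

v3: the frame is LANDED. Stubs A (`stub_dilationFlow`, p155916) and B (`stub_fixedPointCriterion`,
p155958) are tree theorems; the composition no longer goes through B (Ura–Kimura, which needed all of
C, D, E) but through the Butler–Waltman lemma for product-space ω-limit sets (landed:
`…ButlerWaltmanUnstable.lean` p157211, `…ButlerWaltmanStable.lean`), instantiated on the percolation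
objects in the landed glue `…DilationDynamicsGlue.lean`
(`CardyShadowIsolated_of_isolatedInvariant_of_unstableTrivial : CardyIsolatedInvariant →
CardyUnstableTrivial → crux`, and the stable twin). Hence the crux follows from the TWO registered
stubs C and D below (E is kept registered as the alternative to D: crux ⟸ C ∧ E as well).

Objects (all from the tree file `…StubDilationFlow.lean` / the glue, namespace
`Summit.CriticalPhenomena.CardyFormulaZ2.Theorems.CardyShadowIsolated.DilationDynamics`):
`clusterSet` (= Λ', the cluster set of the crux), `dilation s = Homeomorph.mulLeft₀ (e^s : ℂ)`,
`scaleAct s g R = g (R.map (dilation s))`, `IsCardyShadow g` (the crux hypothesis verbatim; exists and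
is unique: `exists_isCardyShadow`, `IsCardyShadow.unique`), `logOrbit s` (crossing function at mesh
`e^{-s}`; `logOrbit_add`, `logOrbit_tail_continuity`, `mem_clusterSet_iff_logOrbit`).

Residual of the line = stubs C and D (or C and E): open-problem grade statements about ACTUAL ℤ²
cluster points (each implied by CardyFormulaZ2; D already by CardySelfRefinement.ScaleInvariantLimits
stmt-10265, E by CardyUniqueLimit.LimitExists stmt-0747); see LEAD-CENSUS-c3.md and the two
STUB-REPORTs in this directory.

Disproof used: no `Disproof.lean` exists for this crux (checked `ledger crux ls` 2026-08-17).
-/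

noncomputable section

namespace Summit.CriticalPhenomena.CardyFormulaZ2.Cruxes.CardyShadowIsolated.DilationDynamics

open Set Filter Topology
open Literature.Probability.RandomPlanarGeometry Literature.Probability.Percolation
open Summit.CriticalPhenomena.CardyFormulaZ2.Theorems.CardyShadowIsolated.DilationDynamics

/-! ### The registered stubs (the ONLY `sorry`s of this file) -/

/-- STUB C — **the Cardy shadow is an isolated invariant set of the RG flow on `Λ'`** (open):
for a Cardy shadow `g ∈ Λ'` there is a product-neighbourhood `N` of `g` (finitely many test
rectangles, one tolerance) such that a cluster point `g'` all of whose dilates `scaleAct s g'`,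
`s ∈ ℝ`, lie in `N` is `g` itself. Excludes nearby fixed points (an exactly marginal self-dual
isotropic direction) and log-periodic RG cycles realised by ℤ² cluster points.
[cite: Cardy1992; Ziff2011; GarbanPeteSchramm2018, §13] -/
protected theorem Holds.stub_cardyIsolatedInvariant :
    ∀ g : ConformalRectangle → ℝ, IsCardyShadow g → g ∈ clusterSet →
      ∃ N ∈ 𝓝 g, ∀ g' ∈ clusterSet, (∀ s : ℝ, scaleAct s g' ∈ N) → g' = g := by
  sorry

/-- By-name handle of STUB C. [folklore] -/
def stub_cardyIsolatedInvariant : Prop := type_of% Holds.stub_cardyIsolatedInvariant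

/-- STUB D — **trivial unstable set: nothing emanates from the Cardy fixed point inside `Λ'`**
(open): a cluster point whose dilates converge to the Cardy shadow as the log-scale `s → -∞`
(Cardy in the ultraviolet) is the Cardy shadow. A counterexample is a RELEVANT self-dual isotropic
RSW-regular trajectory leaving the percolation fixed point inside `Λ'`; by the landed
Butler–Waltman lemma, given C it exists iff `Λ' ≠ {g_F}`. [cite: GarbanPeteSchramm2018, Cor. 86; Cardy1992] -/
protected theorem Holds.stub_cardyUnstableTrivial :
    ∀ g : ConformalRectangle → ℝ, IsCardyShadow g → ∀ g' ∈ clusterSet,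
      Tendsto (fun s : ℝ => scaleAct s g') atBot (𝓝 g) → g' = g := by
  sorry

/-- By-name handle of STUB D. [folklore] -/
def stub_cardyUnstableTrivial : Prop := type_of% Holds.stub_cardyUnstableTrivial

/-- STUB E — **trivial stable set** (open; the ALTERNATIVE to D — not needed when D is proved): a
cluster point whose dilates converge to the Cardy shadow as `s → +∞` (Cardy in the infrared) is
the Cardy shadow. [cite: Ziff2011; SchrammSmirnov2011, §1] -/
protected theorem Holds.stub_cardyStableTrivial :
    ∀ g : ConformalRectangle → ℝ, IsCardyShadow g → ∀ g' ∈ clusterSet,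
      Tendsto (fun s : ℝ => scaleAct s g') atTop (𝓝 g) → g' = g := by
  sorry

/-- By-name handle of STUB E. [folklore] -/
def stub_cardyStableTrivial : Prop := type_of% Holds.stub_cardyStableTrivial

/-! ### Sorry-free composition (through the landed glue) -/

/-- **The skeleton theorem**: stubs C and D imply the crux BY NAME (route CardyAnchoredRigidity),
via the landed Butler–Waltman glue. [cite: ButlerWaltman1986, Lemma A1] -/
theorem CardyShadowIsolated_of (hC : stub_cardyIsolatedInvariant) (hD : stub_cardyUnstableTrivial) :
    Summit.CriticalPhenomena.CardyFormulaZ2.Theses.CardyAnchoredRigidity.CardyShadowIsolated :=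
  CardyShadowIsolated_of_isolatedInvariant_of_unstableTrivial
    (fun g hg hgΛ => hC g hg hgΛ) (fun g hg g' hg' h => hD g hg g' hg' h)

/-- The same for the sibling route's decl (route CardyLocalRigidity; shared item). [cite: ButlerWaltman1986, Lemma A1] -/
theorem CardyShadowIsolated_of_local (hC : stub_cardyIsolatedInvariant)
    (hD : stub_cardyUnstableTrivial) :
    Summit.CriticalPhenomena.CardyFormulaZ2.Theses.CardyLocalRigidity.CardyShadowIsolated :=
  CardyShadowIsolated_of_isolatedInvariant_of_unstableTrivial_local
    (fun g hg hgΛ => hC g hg hgΛ) (fun g hg g' hg' h => hD g hg g' hg' h)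

/-- **Alternative composition**: stubs C and E imply the crux BY NAME (stable half).
[cite: ButlerWaltman1986, Lemma A1] -/
theorem CardyShadowIsolated_of_stable (hC : stub_cardyIsolatedInvariant)
    (hE : stub_cardyStableTrivial) :
    Summit.CriticalPhenomena.CardyFormulaZ2.Theses.CardyAnchoredRigidity.CardyShadowIsolated :=
  CardyShadowIsolated_of_isolatedInvariant_of_stableTrivial
    (fun g hg hgΛ => hC g hg hgΛ) (fun g hg g' hg' h => hE g hg g' hg' h)

/-- The alternative composition for the sibling route's decl. [cite: ButlerWaltman1986, Lemma A1] -/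
theorem CardyShadowIsolated_of_stable_local (hC : stub_cardyIsolatedInvariant)
    (hE : stub_cardyStableTrivial) :
    Summit.CriticalPhenomena.CardyFormulaZ2.Theses.CardyLocalRigidity.CardyShadowIsolated :=
  CardyShadowIsolated_of_isolatedInvariant_of_stableTrivial_local
    (fun g hg hgΛ => hC g hg hgΛ) (fun g hg g' hg' h => hE g hg g' hg' h)

end Summit.CriticalPhenomena.CardyFormulaZ2.Cruxes.CardyShadowIsolated.DilationDynamics

end
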